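import Mathlib
import Summits.QuantumFields.YangMills.Theorems.ScalingWindowSplitSelfNormalisedSkewnessWitnessNoFlux
import Summits.QuantumFields.YangMills.Theorems.ScalingWindowSplitSelfNormalisedSkewnessStubTorusTwoFormExact
import Literature.MathematicalPhysics.QuantumLattice.AbelianBianchiIdentity
import HarnessLib

/-!
# Flux sectors of the small-field region of Wilson `U(1)₄`: admissibility, total plaquette-angle sums,
# reference integer fields, and exactness of the sector-shifted plaquette-angle vector

Route-independent helper for the crux stmt-QuantumFields-23103 `Theses.TransverseWardBL.ConvexPhaseCoexactBound`
(route `TransverseWardBL`, LINE g9-C of the ideator seat ym-idea-4; abelian `U(1)` line onto the leaf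
`Theorems.U1HelicityGapTorusD4` — nothing here bears on the Yang–Mills mass gap).

On the cut `G = {∀ p, |ω_p(U)| ≤ 1}` (`ω = plaqAngle`, Lüscher's abelian field tensor) a configuration is
admissible (`|F| < π/3`, `abs_abelianFieldTensor_lt_of_plaqAngle_le`), so by the tree's Bianchi identity /
flux constancy (`magneticFlux_eq_of_admissible`) the total plaquette-angle sum of each orientation is
`S² ×` the quantised flux `2πk_{μν}` through the coordinate plane at the origin
(`sum_abelianFieldTensor_eq`).  The explicit integer reference field `n_k(x; μ<ν) = k_{μν}·1{x_μ = x_ν = 0}`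
is closed (`td₂_altOf_refField`) with the same total sums (`sum_refField`), hence — by the tree's
`stub_torusTwoFormExact` (closed, zero-sum real `2`-cochains on `(ℤ/S)⁴` are exact) — the shifted vector
`ω(U) − 2π n_k` is EXACT, i.e. lies in `V = im d` (`plaqAngle_sub_ref_mem_range`), and conversely exactness of
`ω(U) − 2πn_k` forces the flux sector `k` (`flux_eq_of_sub_ref_mem_range`).  This is the multi-sector version
of the tree's zero-flux chart lemma `plaqAngle_mem_range_of_small`.
-/

noncomputable section

open scoped BigOperators
open MeasureTheory Finset
open Literature.MathematicalPhysics.QuantumLattice Literature.MathematicalPhysics.QuantumFieldTheory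
open Summit.QuantumFields.YangMills.Theorems.SelfNormalisedSkewness.Negative

namespace Summit.QuantumFields.YangMills.Theorems.TransverseWardBL

variable {S : ℕ} [NeZero S]

/-! ### Admissibility on the cut -/

omit [NeZero S] in
/-- A degenerate plaquette has trivial holonomy. [folklore] -/
theorem plaquetteHolonomy_self_eq_one {G : Type*} [Group G] (U : GaugeConfig 4 S G) (x : Site 4 S)
    (i : Fin 4) : plaquetteHolonomy U x i i = 1 := by
  simp [plaquetteHolonomy]

omit [NeZero S] in
/-- **On the cut the field is admissible**: `|ω_p(U)| ≤ 1` for all genuine plaquettes gives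
`|F_{αβ}(y)| < π/3` for ALL index pairs (diagonal: `F = 0`; reversed: `F_{βα} = −F_{αβ}`). [folklore] -/
theorem abs_abelianFieldTensor_lt_of_plaqAngle_le {U : GaugeConfig 4 S Circle}
    (hU : ∀ p : Plaquette 4 S, |plaqAngle U p| ≤ 1) (y : Site 4 S) (α β : Fin 4) :
    |abelianFieldTensor U y α β| < Real.pi / 3 := by
  have hπ : (1 : ℝ) < Real.pi / 3 := by linarith [Real.pi_gt_three]
  have key : ∀ (y : Site 4 S) (α β : Fin 4), α < β → |abelianFieldTensor U y α β| ≤ 1 := fun y α β h => by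
    have := hU (y, ⟨(α, β), h⟩)
    rwa [plaqAngle_apply] at this
  rcases lt_trichotomy α β with h | rfl | h
  · exact (key y α β h).trans_lt hπ
  · have : abelianFieldTensor U y α α = 0 := by
      simp [abelianFieldTensor, plaquetteHolonomy_self_eq_one]
    rw [this, abs_zero]; positivity
  · have h1 := key y β α h
    have hne : abelianFieldTensor U y β α ≠ Real.pi := by
      intro heq; rw [heq, abs_of_pos Real.pi_pos] at h1; linarith [Real.pi_gt_three]
    rw [abelianFieldTensor_swap U y β α hne, abs_neg]
    exact h1.trans_lt hπ

/-! ### Plane sums and total sums -/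

/-- **Double counting of plane sums**: `Σ_x Σ_{s,t} f(x + s μ̂ + t ν̂) = S² Σ_x f(x)`. [folklore] -/
theorem sum_planeSum_eq (f : Site 4 S → ℝ) (μ ν : Fin 4) :
    ∑ x : Site 4 S, ∑ s : ZMod S, ∑ t : ZMod S, f (x + Pi.single μ s + Pi.single ν t) =
      (S : ℝ) ^ 2 * ∑ x : Site 4 S, f x := by
  have h : ∀ s t : ZMod S, ∑ x : Site 4 S, f (x + Pi.single μ s + Pi.single ν t) = ∑ x : Site 4 S, f x :=
    fun s t => Fintype.sum_equiv (Equiv.addRight (Pi.single μ s + Pi.single ν t)) _ _ fun x => by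
      simp [add_assoc]
  rw [Finset.sum_comm]
  simp_rw [Finset.sum_comm (s := (Finset.univ : Finset (Site 4 S))), h]
  simp [Finset.sum_const, ZMod.card, sq, mul_assoc]

/-- The torus `(ℤ/S)⁴` has `S⁴` sites. [folklore] -/
theorem card_site : Fintype.card (Site 4 S) = S ^ 4 := by
  simp [ZMod.card]

/-- **Total plaquette-angle sums on the cut**: for `U` with `|ω_p(U)| ≤ 1` for all `p`,
`Σ_x F_{μν}(x) = S² · φ_{μν}(0)` (flux constancy of admissible fields). [folklore] -/
theorem sum_abelianFieldTensor_eq {U : GaugeConfig 4 S Circle} (hU : ∀ p : Plaquette 4 S, |plaqAngle U p| ≤ 1)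
    (μ ν : Fin 4) :
    ∑ x : Site 4 S, abelianFieldTensor U x μ ν = (S : ℝ) ^ 2 * magneticFlux U 0 μ ν := by
  have hadm := abs_abelianFieldTensor_lt_of_plaqAngle_le hU
  have h1 := sum_planeSum_eq (S := S) (fun x => abelianFieldTensor U x μ ν) μ ν
  have h2 : ∑ x : Site 4 S, ∑ s : ZMod S, ∑ t : ZMod S,
      abelianFieldTensor U (x + Pi.single μ s + Pi.single ν t) μ ν =
      ∑ x : Site 4 S, magneticFlux U 0 μ ν := by
    refine Finset.sum_congr rfl fun x _ => ?_
    rw [← magneticFlux_eq_of_admissible U hadm x 0 μ ν, magneticFlux]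
  rw [h2, Finset.sum_const, Finset.card_univ, card_site, nsmul_eq_mul] at h1
  have hS : (S : ℝ) ≠ 0 := by exact_mod_cast (NeZero.ne S)
  have hS2 : (S : ℝ) ^ 2 ≠ 0 := pow_ne_zero 2 hS
  have : (S : ℝ) ^ 2 * ((S : ℝ) ^ 2 * magneticFlux U 0 μ ν) = (S : ℝ) ^ 2 * ∑ x : Site 4 S, abelianFieldTensor U x μ ν := by
    rw [← h1]; push_cast; ring
  exact (mul_left_cancel₀ hS2 this).symm

/-- The flux through the origin plane of orientation `o` is `2π ×` an integer (choice). [folklore] -/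
theorem exists_fluxIndex (U : GaugeConfig 4 S Circle) :
    ∃ k : {q : Fin 4 × Fin 4 // q.1 < q.2} → ℤ, ∀ o, magneticFlux U 0 o.1.1 o.1.2 = 2 * Real.pi * k o :=
  ⟨fun o => (exists_int_magneticFlux_eq U 0 o.1.1 o.1.2).choose,
    fun o => (exists_int_magneticFlux_eq U 0 o.1.1 o.1.2).choose_spec⟩

/-! ### The reference integer field of a flux sector -/

/-- **Total sums of the reference field** `n_k(x; o) = k_o · 1{x_{o₁} = x_{o₂} = 0}`:
`Σ_x n_k(x; o) = S² k_o`. [folklore] -/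
theorem sum_refField (k : {q : Fin 4 × Fin 4 // q.1 < q.2} → ℤ) (o : {q : Fin 4 × Fin 4 // q.1 < q.2}) :
    ∑ x : Site 4 S, (if x o.1.1 = 0 ∧ x o.1.2 = 0 then (k o : ℝ) else 0) = (S : ℝ) ^ 2 * k o := by
  have hne : o.1.1 ≠ o.1.2 := ne_of_lt o.2
  set f : Site 4 S → ℝ := fun x => if x o.1.1 = 0 ∧ x o.1.2 = 0 then (k o : ℝ) else 0 with hf
  -- every plane sum of `f` equals `k o`
  have hplane : ∀ x : Site 4 S, ∑ s : ZMod S, ∑ t : ZMod S,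
      f (x + Pi.single o.1.1 s + Pi.single o.1.2 t) = k o := by
    intro x
    have hc : ∀ s t : ZMod S, f (x + Pi.single o.1.1 s + Pi.single o.1.2 t) =
        if s = -x o.1.1 then (if t = -x o.1.2 then (k o : ℝ) else 0) else 0 := by
      intro s t
      have e1 : (x o.1.1 + s = 0) ↔ (s = -x o.1.1) := by
        constructor <;> intro h <;> linear_combination h
      have e2 : (x o.1.2 + t = 0) ↔ (t = -x o.1.2) := by
        constructor <;> intro h <;> linear_combination h
      simp only [hf, Pi.add_apply, Pi.single_eq_same, Pi.single_eq_of_ne hne, Pi.single_eq_of_ne hne.symm,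
        add_zero, e1, e2]
      by_cases hs : s = -x o.1.1 <;> by_cases ht : t = -x o.1.2 <;> simp [hs, ht]
    simp_rw [hc]
    simp [Finset.sum_ite_eq', Finset.mem_univ]
  have h1 := sum_planeSum_eq (S := S) f o.1.1 o.1.2
  simp_rw [hplane] at h1
  rw [Finset.sum_const, Finset.card_univ, card_site, nsmul_eq_mul] at h1
  have hS : (S : ℝ) ≠ 0 := by exact_mod_cast (NeZero.ne S)
  have hS2 : (S : ℝ) ^ 2 ≠ 0 := pow_ne_zero 2 hS
  have : (S : ℝ) ^ 2 * ((S : ℝ) ^ 2 * k o) = (S : ℝ) ^ 2 * ∑ x : Site 4 S, f x := by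
    rw [← h1]; push_cast; ring
  exact (mul_left_cancel₀ hS2 this).symm

omit [NeZero S] in
/-- **The reference field is closed**: `td₂ (altOf n_k) = 0` — `n_k(·; j, l)` depends only on the
coordinates `j, l`, so every forward difference in a third direction vanishes. [folklore] -/
theorem td₂_altOf_refField (k : {q : Fin 4 × Fin 4 // q.1 < q.2} → ℤ) :
    LatticeForm.td₂ (altOf (fun p : Plaquette 4 S =>
      ((if p.1 p.2.1.1 = 0 ∧ p.1 p.2.1.2 = 0 then k p.2 else 0 : ℤ) : ℝ))) = 0 := by
  set n : Plaquette 4 S → ℝ := fun p => ((if p.1 p.2.1.1 = 0 ∧ p.1 p.2.1.2 = 0 then k p.2 else 0 : ℤ) : ℝ)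
    with hn
  -- transverse invariance of the reference field
  have hinv : ∀ (x : Site 4 S) (i j l : Fin 4) (hjl : j < l), i ≠ j → i ≠ l →
      n (x + LatticeForm.te i, ⟨(j, l), hjl⟩) = n (x, ⟨(j, l), hjl⟩) := by
    intro x i j l hjl hij hil
    simp only [hn, LatticeForm.te, Pi.add_apply, Pi.single_eq_of_ne hij.symm, Pi.single_eq_of_ne hil.symm,
      add_zero]
  funext x i j l
  refine LatticeForm.td₂_eq_zero_of_sorted (isAlt_altOf n) (fun y a b c hab hbc => ?_) x i j l
  have hac : a < c := hab.trans hbc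
  simp only [LatticeForm.td₂, altOf_of_lt _ _ hbc, altOf_of_lt _ _ hac, altOf_of_lt _ _ hab]
  rw [hinv y a b c hbc (ne_of_lt hab) (ne_of_lt hac), hinv y b a c hac (ne_of_gt hab) (ne_of_lt hbc),
    hinv y c a b hab (ne_of_gt hac) (ne_of_gt hbc)]
  ring

/-! ### Linear algebra of `altOf` and `td₂` -/

omit [NeZero S] in
/-- `altOf` of a difference. [folklore] -/
theorem altOf_sub (ω ω' : Plaquette 4 S → ℝ) : altOf (ω - ω') = altOf ω - altOf ω' := by
  funext x i j
  simp only [altOf, Pi.sub_apply]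
  split_ifs <;> ring

omit [NeZero S] in
/-- `td₂` of a difference. [folklore] -/
theorem td₂_sub (a b : Site 4 S → Fin 4 → Fin 4 → ℝ) :
    LatticeForm.td₂ (a - b) = LatticeForm.td₂ a - LatticeForm.td₂ b := by
  funext x i j l
  simp only [LatticeForm.td₂, Pi.sub_apply]
  ring

omit [NeZero S] in
/-- `altOf` of a scalar multiple (left). [folklore] -/
theorem altOf_const_mul (c : ℝ) (ω : Plaquette 4 S → ℝ) :
    altOf (fun p => c * ω p) = fun x i j => c * altOf ω x i j := by
  funext x i j
  simp only [altOf]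
  split_ifs <;> ring

omit [NeZero S] in
/-- `td₂` of a scalar multiple. [folklore] -/
theorem td₂_const_mul (c : ℝ) (a : Site 4 S → Fin 4 → Fin 4 → ℝ) :
    LatticeForm.td₂ (fun x i j => c * a x i j) = fun x i j l => c * LatticeForm.td₂ a x i j l := by
  funext x i j l
  simp only [LatticeForm.td₂]
  ring

/-! ### The plaquette-angle cochain on the cut is closed -/

omit [NeZero S] in
/-- On the cut the alternating plaquette-angle cochain is closed (lattice Bianchi identity: the cube flux
is in `2πℤ` and smaller than `6 < 2π`). [folklore] -/
theorem td₂_altOf_plaqAngle {U : GaugeConfig 4 S Circle} (hU : ∀ p : Plaquette 4 S, |plaqAngle U p| ≤ 1) :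
    LatticeForm.td₂ (altOf (fun p => plaqAngle U p)) = 0 := by
  classical
  obtain ⟨m, hm⟩ := exists_int_plaqCoboundary_arg_eq U
  set θ : Edge 4 S → ℝ := fun e => Complex.arg (U e : ℂ) with hθ
  set r := altOf (fun p => plaqAngle U p) with hr
  have hdecomp : r = LatticeForm.td₁ (fun x i => θ (x, i)) -
      fun x i j => ((altOf m x i j : ℤ) : ℝ) * (2 * Real.pi) := by
    have e1 : (fun p => plaqCoboundary S θ p) = (fun p => plaqAngle U p) + fun p => (m p : ℝ) * (2 * Real.pi) := by
      funext p; simp [hm p]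
    rw [← altOf_plaqCoboundary, e1, altOf_add]
    have e2 : altOf (fun p => (m p : ℝ) * (2 * Real.pi)) =
        fun x i j => ((altOf m x i j : ℤ) : ℝ) * (2 * Real.pi) := by
      rw [altOf_mul_const (fun p => (m p : ℝ)) (2 * Real.pi), altOf_intCast]
    rw [e2, hr]
    abel
  have hsmall : ∀ x i j, |r x i j| ≤ 1 := by
    intro x i j
    simp only [hr, altOf]
    split_ifs with h h'
    · exact hU _
    · rw [abs_neg]; exact hU _
    · simp
  funext x i j k
  have hint : LatticeForm.td₂ r x i j k = (-(LatticeForm.td₂ (altOf m) x i j k : ℤ) : ℝ) * (2 * Real.pi) := by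
    rw [hdecomp]
    have : LatticeForm.td₂ (LatticeForm.td₁ (fun x i => θ (x, i)) -
        fun x i j => ((altOf m x i j : ℤ) : ℝ) * (2 * Real.pi)) x i j k =
        LatticeForm.td₂ (LatticeForm.td₁ (fun x i => θ (x, i))) x i j k -
          LatticeForm.td₂ (fun x i j => ((altOf m x i j : ℤ) : ℝ) * (2 * Real.pi)) x i j k := by
      simp only [LatticeForm.td₂, Pi.sub_apply]; ring
    rw [this, LatticeForm.td₂_td₁]
    simp only [Pi.zero_apply, zero_sub, LatticeForm.td₂]
    push_cast
    ring
  have hlt : |LatticeForm.td₂ r x i j k| < 2 * Real.pi := by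
    have hb : |LatticeForm.td₂ r x i j k| ≤ 6 := by
      simp only [LatticeForm.td₂]
      have h1 := hsmall (x + LatticeForm.te i) j k; have h2 := hsmall x j k
      have h3 := hsmall (x + LatticeForm.te j) i k; have h4 := hsmall x i k
      have h5 := hsmall (x + LatticeForm.te k) i j; have h6 := hsmall x i j
      rw [abs_le] at h1 h2 h3 h4 h5 h6 ⊢
      constructor <;> linarith [h1.1, h1.2, h2.1, h2.2, h3.1, h3.2, h4.1, h4.2, h5.1, h5.2, h6.1, h6.2]
    linarith [Real.pi_gt_three]
  simpa using eq_zero_of_intCast_mul_two_pi_of_abs_lt (k := -LatticeForm.td₂ (altOf m) x i j k)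
    (by rw [hint]; push_cast; ring) hlt

/-! ### Exactness of the sector-shifted plaquette-angle vector -/

/-- Total sums of `altOf ω` at a sorted pair are the plain plaquette sums. [folklore] -/
theorem sum_altOf_of_lt (ω : Plaquette 4 S → ℝ) {μ ν : Fin 4} (h : μ < ν) :
    ∑ x : Site 4 S, altOf ω x μ ν = ∑ x : Site 4 S, ω (x, ⟨(μ, ν), h⟩) :=
  Finset.sum_congr rfl fun x _ => altOf_of_lt ω x h

/-- **The sector-shifted plaquette-angle vector is exact.**  If `|ω_p(U)| ≤ 1` for all `p` and the fluxes
through the origin planes are `2πk_{μν}`, then `ω(U) − 2π n_k ∈ V = im d`. [folklore] -/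
theorem plaqAngle_sub_ref_mem_range {U : GaugeConfig 4 S Circle} (hU : ∀ p : Plaquette 4 S, |plaqAngle U p| ≤ 1)
    (k : {q : Fin 4 × Fin 4 // q.1 < q.2} → ℤ) (hk : ∀ o, magneticFlux U 0 o.1.1 o.1.2 = 2 * Real.pi * k o) :
    plaqAngle U - WithLp.toLp 2 (fun p : Plaquette 4 S =>
        2 * Real.pi * ((if p.1 p.2.1.1 = 0 ∧ p.1 p.2.1.2 = 0 then k p.2 else 0 : ℤ) : ℝ)) ∈
      LinearMap.range (plaqCoboundary S) := by
  classical
  set n : Plaquette 4 S → ℝ := fun p => ((if p.1 p.2.1.1 = 0 ∧ p.1 p.2.1.2 = 0 then k p.2 else 0 : ℤ) : ℝ)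
    with hn
  set wv : Plaquette 4 S → ℝ := fun p => plaqAngle U p - 2 * Real.pi * n p with hwv
  set w := altOf wv with hw
  have hw_eq : w = altOf (fun p => plaqAngle U p) - fun x i j => 2 * Real.pi * altOf n x i j := by
    have : wv = (fun p => plaqAngle U p) - fun p => 2 * Real.pi * n p := by funext p; simp [hwv]
    rw [hw, this, altOf_sub, altOf_const_mul]
  -- closed
  have hclosed : LatticeForm.td₂ w = 0 := by
    rw [hw_eq, td₂_sub, td₂_altOf_plaqAngle hU, td₂_const_mul, td₂_altOf_refField k]
    funext x i j l; simp
  -- zero total sums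
  have hflux : ∀ μ ν : Fin 4, ∑ x : Site 4 S, w x μ ν = 0 := by
    have hlt : ∀ μ ν : Fin 4, μ < ν → ∑ x : Site 4 S, w x μ ν = 0 := by
      intro μ ν h
      rw [hw, sum_altOf_of_lt wv h]
      simp only [hwv, Finset.sum_sub_distrib, ← Finset.mul_sum, plaqAngle_apply]
      rw [sum_abelianFieldTensor_eq hU μ ν, hk ⟨(μ, ν), h⟩]
      have := sum_refField (S := S) k ⟨(μ, ν), h⟩
      simp only [hn]
      push_cast
      rw [this]
      ring
    intro μ ν
    rcases lt_trichotomy μ ν with h | rfl | h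
    · exact hlt μ ν h
    · simp [hw, (isAlt_altOf wv).2]
    · have : ∀ x, w x μ ν = -w x ν μ := fun x => (isAlt_altOf wv).1 x ν μ
      simp only [this, Finset.sum_neg_distrib, hlt ν μ h, neg_zero]
  obtain ⟨θ', hθ'⟩ := stub_torusTwoFormExact S w (isAlt_altOf wv) hclosed hflux
  refine ⟨fun e => θ' e.1 e.2, ?_⟩
  ext ⟨x, ⟨⟨i, j⟩, hij⟩⟩
  have h1 : plaqCoboundary S (fun e => θ' e.1 e.2) (x, ⟨(i, j), hij⟩) = LatticeForm.td₁ θ' x i j := by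
    rw [plaqCoboundary_apply]; simp [LatticeForm.td₁, LatticeForm.te]
  rw [h1, hθ', hw, altOf_of_lt _ _ hij]
  simp [hwv, hn]

/-- **Conversely, exactness fixes the sector**: if `|ω_p(U)| ≤ 1` for all `p` and `ω(U) − 2πn_k` is exact,
then the fluxes through the origin planes are `2πk_{μν}`. [folklore] -/
theorem flux_eq_of_sub_ref_mem_range {U : GaugeConfig 4 S Circle} (hU : ∀ p : Plaquette 4 S, |plaqAngle U p| ≤ 1)
    (k : {q : Fin 4 × Fin 4 // q.1 < q.2} → ℤ)
    (hmem : plaqAngle U - WithLp.toLp 2 (fun p : Plaquette 4 S =>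
        2 * Real.pi * ((if p.1 p.2.1.1 = 0 ∧ p.1 p.2.1.2 = 0 then k p.2 else 0 : ℤ) : ℝ)) ∈
      LinearMap.range (plaqCoboundary S)) (o : {q : Fin 4 × Fin 4 // q.1 < q.2}) :
    magneticFlux U 0 o.1.1 o.1.2 = 2 * Real.pi * k o := by
  classical
  obtain ⟨θ', hθ'⟩ := hmem
  obtain ⟨⟨μ, ν⟩, hμν⟩ := o
  -- total sum of the exact vector vanishes
  have hsum : ∑ x : Site 4 S, (plaqAngle U (x, ⟨(μ, ν), hμν⟩) -
      2 * Real.pi * ((if x μ = 0 ∧ x ν = 0 then k ⟨(μ, ν), hμν⟩ else 0 : ℤ) : ℝ)) = 0 := by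
    have h1 : ∀ x : Site 4 S, plaqCoboundary S θ' (x, ⟨(μ, ν), hμν⟩) =
        plaqAngle U (x, ⟨(μ, ν), hμν⟩) -
          2 * Real.pi * ((if x μ = 0 ∧ x ν = 0 then k ⟨(μ, ν), hμν⟩ else 0 : ℤ) : ℝ) := fun x => by
      have := congrArg (fun v : EuclideanSpace ℝ (Plaquette 4 S) => v (x, ⟨(μ, ν), hμν⟩)) hθ'
      simpa using this
    rw [← Finset.sum_congr rfl fun x _ => h1 x]
    have h2 : ∀ x : Site 4 S, plaqCoboundary S θ' (x, ⟨(μ, ν), hμν⟩) =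
        LatticeForm.td₁ (fun y i => θ' (y, i)) x μ ν := fun x => by
      rw [plaqCoboundary_apply]; simp [LatticeForm.td₁, LatticeForm.te]
    simp_rw [h2]
    exact sum_td₁_eq_zero _ μ ν
  rw [Finset.sum_sub_distrib, ← Finset.mul_sum] at hsum
  simp only [plaqAngle_apply] at hsum
  rw [sum_abelianFieldTensor_eq hU μ ν] at hsum
  have href := sum_refField (S := S) k ⟨(μ, ν), hμν⟩
  simp only at href
  push_cast at hsum
  rw [href] at hsum
  have hS : (S : ℝ) ≠ 0 := by exact_mod_cast (NeZero.ne S)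
  have hS2 : (S : ℝ) ^ 2 ≠ 0 := pow_ne_zero 2 hS
  have : (S : ℝ) ^ 2 * magneticFlux U 0 μ ν = (S : ℝ) ^ 2 * (2 * Real.pi * k ⟨(μ, ν), hμν⟩) := by linarith
  exact mul_left_cancel₀ hS2 this

end Summit.QuantumFields.YangMills.Theorems.TransverseWardBL

end
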